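import Mathlib
import Literature.Probability.LatticeModels.DiscreteParseval
import HarnessLib

/-!
# Orthogonality of characters on `[-π,π]^d` and a Parseval identity against block weights

Helper file for item `stmt-CriticalPhenomena-4804`
(`Summit.CriticalPhenomena.Ising3DConformalLimit.Theses.PrecisionLaplacian.EtaBoundsTransfer`), part of its
unconditional proof: potential theory of inverse M-matrices ⇒ infinite-volume equation and Green-function
representation; Fourier analysis on `[-π,π]^d` ⇒ block-sum upper bounds; quadratic test function ⇒ ball-sum
lower bounds; Messager–Miracle-Solé ⇒ pointwise two-sided power bounds. No definitions are introduced: the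
objects (kernel matrices, box sequences, convolution powers) enter through defining hypotheses.
-/

namespace Summit.CriticalPhenomena.Ising3DConformalLimit.Theorems.EtaBoundsTransfer

open Finset Real MeasureTheory Literature.Probability.LatticeModels
open scoped BigOperators

section Ortho

variable {d : ℕ}

/-- `∫_{-π}^{π} e^{i m t} dt = 2π [m = 0]` for `m ∈ ℤ`. -/
theorem integral_Icc_cexp_int_mul (m : ℤ) :
    ∫ t in Set.Icc (-π) π, Complex.exp ((m : ℂ) * (t : ℂ) * Complex.I)
      = if m = 0 then (2 * π : ℂ) else 0 := by
  have hπ := Real.pi_pos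
  rw [integral_Icc_eq_integral_Ioc, ← intervalIntegral.integral_of_le (by linarith)]
  by_cases hm : m = 0
  · subst hm
    simp only [Int.cast_zero, zero_mul, Complex.exp_zero, if_true]
    rw [intervalIntegral.integral_const]
    simp only [sub_neg_eq_add, Complex.real_smul, mul_one]
    push_cast; ring
  · rw [if_neg hm]
    have hc : (m : ℂ) * Complex.I ≠ 0 := mul_ne_zero (by exact_mod_cast hm) Complex.I_ne_zero
    have h1 : ∀ t : ℝ, Complex.exp ((m : ℂ) * (t : ℂ) * Complex.I) = Complex.exp ((m : ℂ) * Complex.I * t) := by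
      intro t; ring_nf
    simp_rw [h1]
    rw [integral_exp_mul_complex hc]
    have h2 : Complex.exp ((m : ℂ) * Complex.I * (π : ℝ)) = Complex.exp ((m : ℂ) * Complex.I * (((-π : ℝ)) : ℂ)) := by
      have h3 : (m : ℂ) * Complex.I * (π : ℝ) = (m : ℂ) * Complex.I * (((-π : ℝ)) : ℂ) + m * (2 * π * Complex.I) := by
        push_cast; ring
      rw [h3, Complex.exp_add, Complex.exp_int_mul_two_pi_mul_I, mul_one]
    rw [h2, sub_self, zero_div]

/-- The character `k ↦ e^{i k·z}` factorises over coordinates. -/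
theorem cexp_phase_eq_prod (k : Fin d → ℝ) (z : Site d) :
    Complex.exp ((phase d k z : ℝ) * Complex.I)
      = ∏ j : Fin d, Complex.exp (((z j : ℤ) : ℂ) * ((k j : ℝ) : ℂ) * Complex.I) := by
  rw [← Complex.exp_sum, phase]
  congr 1
  push_cast
  rw [Finset.sum_mul]
  refine Finset.sum_congr rfl fun j _ => ?_
  ring

/-- **Orthogonality of characters on the cube**: `∫_{[-π,π]^d} e^{i k·z} dk = (2π)^d [z = 0]`. -/
theorem integral_cube_cexp_phase (z : Site d) :
    ∫ k in Set.pi Set.univ (fun _ : Fin d => Set.Icc (-π) π), Complex.exp ((phase d k z : ℝ) * Complex.I)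
      = if z = 0 then ((2 * π : ℂ)) ^ d else 0 := by
  simp_rw [cexp_phase_eq_prod]
  rw [MeasureTheory.volume_pi, MeasureTheory.Measure.restrict_pi_pi]
  rw [MeasureTheory.integral_fintype_prod_eq_prod
    (fun (j : Fin d) (t : ℝ) => Complex.exp (((z j : ℤ) : ℂ) * ((t : ℝ) : ℂ) * Complex.I))]
  have h1 : ∀ j : Fin d, ∫ t, Complex.exp (((z j : ℤ) : ℂ) * ((t : ℝ) : ℂ) * Complex.I)
      ∂((volume : Measure ℝ).restrict (Set.Icc (-π) π)) = if z j = 0 then (2 * π : ℂ) else 0 :=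
    fun j => integral_Icc_cexp_int_mul (z j)
  simp_rw [h1]
  by_cases hz : z = 0
  · subst hz
    simp
  · rw [if_neg hz]
    obtain ⟨j, hj⟩ : ∃ j, z j ≠ 0 := by
      by_contra h
      push Not at h
      exact hz (funext h)
    exact Finset.prod_eq_zero (Finset.mem_univ j) (by rw [if_neg hj])

/-- The cube `[-π,π]^d` is compact. -/
theorem isCompact_cube : IsCompact (Set.pi Set.univ (fun _ : Fin d => Set.Icc (-π) π)) :=
  isCompact_univ_pi fun _ => isCompact_Icc

/-- The cube has finite volume. -/
theorem volume_cube_lt_top : volume (Set.pi Set.univ (fun _ : Fin d => Set.Icc (-π) π)) < ⊤ :=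
  isCompact_cube.measure_lt_top

/-- A continuous function is integrable on the cube. -/
theorem integrableOn_cube_of_continuous {E : Type*} [NormedAddCommGroup E] {F : (Fin d → ℝ) → E}
    (hF : Continuous F) : IntegrableOn F (Set.pi Set.univ (fun _ : Fin d => Set.Icc (-π) π)) :=
  hF.continuousOn.integrableOn_compact isCompact_cube

/-- `k ↦ phase d k z` is continuous. -/
theorem continuous_phase (z : Site d) : Continuous fun k : Fin d → ℝ => phase d k z := by
  unfold phase
  fun_prop

/-- **Orthogonality, real form**: `∫_{[-π,π]^d} cos(k·z) dk = (2π)^d [z = 0]`. -/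
theorem integral_cube_cos_phase (z : Site d) :
    ∫ k in Set.pi Set.univ (fun _ : Fin d => Set.Icc (-π) π), Real.cos (phase d k z)
      = if z = 0 then (2 * π) ^ d else 0 := by
  have hint : Integrable (fun k : Fin d → ℝ => Complex.exp ((phase d k z : ℝ) * Complex.I))
      (volume.restrict (Set.pi Set.univ (fun _ : Fin d => Set.Icc (-π) π))) :=
    integrableOn_cube_of_continuous (by have := continuous_phase z; fun_prop)
  have h := integral_re hint
  simp only [RCLike.re_to_complex, Complex.exp_ofReal_mul_I_re] at h
  rw [h, integral_cube_cexp_phase]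
  split_ifs
  · rw [show ((2 : ℂ) * (π : ℂ)) ^ d = (((2 * π) ^ d : ℝ) : ℂ) by push_cast; ring, Complex.ofReal_re]
  · simp

/-- `∫_{[-π,π]^d} cos(k·z) cos(k·w) dk = (2π)^d/2 · ([z = w] + [z = -w])`. -/
theorem integral_cube_cos_mul_cos (z w : Site d) :
    ∫ k in Set.pi Set.univ (fun _ : Fin d => Set.Icc (-π) π),
        Real.cos (phase d k z) * Real.cos (phase d k w)
      = (2 * π) ^ d / 2 * ((if z = w then 1 else 0) + (if z = -w then 1 else 0)) := by
  have h1 : ∀ k : Fin d → ℝ, Real.cos (phase d k z) * Real.cos (phase d k w)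
      = (1 / 2) * Real.cos (phase d k (z - w)) + (1 / 2) * Real.cos (phase d k (z + w)) := by
    intro k
    rw [phase_sub, phase_add, Real.cos_sub, Real.cos_add]
    ring
  simp_rw [h1]
  have hi : ∀ u : Site d, Integrable (fun k : Fin d → ℝ => (1 / 2 : ℝ) * Real.cos (phase d k u))
      (volume.restrict (Set.pi Set.univ (fun _ : Fin d => Set.Icc (-π) π))) :=
    fun u => integrableOn_cube_of_continuous (by have := continuous_phase u; fun_prop)
  rw [integral_add (hi _) (hi _), integral_const_mul, integral_const_mul,
    integral_cube_cos_phase, integral_cube_cos_phase]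
  simp only [sub_eq_zero, add_eq_zero_iff_eq_neg]
  split_ifs <;> ring

/-- **Parseval identity against a block weight**: for a summable `f : ℤ^d → ℝ` and a finite set
`B`, `∫_{[-π,π]^d} f̂_c(k) · ∑_{y,y' ∈ B} cos(k·(y − y')) dk = (2π)^d ∑_{y,y' ∈ B} f (y − y')`,
where `f̂_c(k) = ∑_z f(z) cos(k·z)`. -/
theorem parseval_block {f : Site d → ℝ} (hf : Summable f) (B : Finset (Site d)) :
    ∫ k in Set.pi Set.univ (fun _ : Fin d => Set.Icc (-π) π),
        (∑' z, f z * Real.cos (phase d k z)) * (∑ y ∈ B, ∑ y' ∈ B, Real.cos (phase d k (y - y')))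
      = (2 * π) ^ d * ∑ y ∈ B, ∑ y' ∈ B, f (y - y') := by
  set K := Set.pi Set.univ (fun _ : Fin d => Set.Icc (-π) π) with hK
  set μ : Measure (Fin d → ℝ) := volume.restrict K with hμ
  haveI : IsFiniteMeasure μ := ⟨by rw [hμ, Measure.restrict_apply_univ]; exact volume_cube_lt_top⟩
  -- the summands `F z k = f z cos(k·z) W(k)`
  set W : (Fin d → ℝ) → ℝ := fun k => ∑ y ∈ B, ∑ y' ∈ B, Real.cos (phase d k (y - y')) with hW
  have hWcont : Continuous W := by
    simp only [hW]
    refine continuous_finsetSum _ fun y _ => continuous_finsetSum _ fun y' _ => ?_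
    have := continuous_phase (d := d) (y - y'); fun_prop
  have hWbd : ∀ k, |W k| ≤ (B.card : ℝ) ^ 2 := by
    intro k
    simp only [hW]
    calc |∑ y ∈ B, ∑ y' ∈ B, Real.cos (phase d k (y - y'))|
        ≤ ∑ y ∈ B, |∑ y' ∈ B, Real.cos (phase d k (y - y'))| := Finset.abs_sum_le_sum_abs _ _
      _ ≤ ∑ y ∈ B, ∑ y' ∈ B, |Real.cos (phase d k (y - y'))| :=
          Finset.sum_le_sum fun y _ => Finset.abs_sum_le_sum_abs _ _
      _ ≤ ∑ y ∈ B, ∑ y' ∈ B, (1 : ℝ) :=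
          Finset.sum_le_sum fun y _ => Finset.sum_le_sum fun y' _ => Real.abs_cos_le_one _
      _ = (B.card : ℝ) ^ 2 := by simp [sq]
  set F : Site d → (Fin d → ℝ) → ℝ := fun z k => f z * Real.cos (phase d k z) * W k with hF
  have hFcont : ∀ z, Continuous (F z) := by
    intro z; simp only [hF]; have := continuous_phase (d := d) z; fun_prop
  have hFint : ∀ z, Integrable (F z) μ := fun z =>
    integrableOn_cube_of_continuous (hFcont z)
  have hFbd : ∀ z k, ‖F z k‖ ≤ |f z| * (B.card : ℝ) ^ 2 := by
    intro z k
    rw [Real.norm_eq_abs, hF]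
    simp only
    rw [abs_mul, abs_mul]
    calc |f z| * |Real.cos (phase d k z)| * |W k| ≤ |f z| * 1 * (B.card : ℝ) ^ 2 :=
          mul_le_mul (mul_le_mul_of_nonneg_left (Real.abs_cos_le_one _) (abs_nonneg _)) (hWbd k)
            (abs_nonneg _) (by positivity)
      _ = |f z| * (B.card : ℝ) ^ 2 := by ring
  have hFsum : Summable fun z => ∫ k, ‖F z k‖ ∂μ := by
    refine Summable.of_nonneg_of_le (fun z => integral_nonneg fun k => norm_nonneg _)
      (fun z => ?_) ((hf.abs.mul_right ((B.card : ℝ) ^ 2)).mul_right (μ.real Set.univ))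
    calc ∫ k, ‖F z k‖ ∂μ ≤ ∫ k, |f z| * (B.card : ℝ) ^ 2 ∂μ :=
          integral_mono (hFint z).norm (integrable_const _) (hFbd z)
      _ = |f z| * (B.card : ℝ) ^ 2 * μ.real Set.univ := by
          rw [integral_const, smul_eq_mul]; ring
  -- Step 1: swap integral and sum
  have hswap : ∫ k, (∑' z, f z * Real.cos (phase d k z)) * W k ∂μ = ∑' z, ∫ k, F z k ∂μ := by
    rw [integral_tsum_of_summable_integral_norm hFint hFsum]
    refine integral_congr_ae (Filter.Eventually.of_forall fun k => ?_)
    simp only [hF]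
    rw [← tsum_mul_right]
  -- Step 2: compute each integral
  have hterm : ∀ z, ∫ k, F z k ∂μ
      = (2 * π) ^ d / 2 * (f z * ∑ y ∈ B, ∑ y' ∈ B,
          ((if z = y - y' then 1 else 0) + (if z = -(y - y') then 1 else 0))) := by
    intro z
    simp only [hF, hW]
    have h1 : ∀ k : Fin d → ℝ, f z * Real.cos (phase d k z) * ∑ y ∈ B, ∑ y' ∈ B, Real.cos (phase d k (y - y'))
        = ∑ y ∈ B, ∑ y' ∈ B, f z * (Real.cos (phase d k z) * Real.cos (phase d k (y - y'))) := by
      intro k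
      rw [Finset.mul_sum]
      refine Finset.sum_congr rfl fun y _ => ?_
      rw [Finset.mul_sum]
      refine Finset.sum_congr rfl fun y' _ => ?_
      ring
    simp_rw [h1]
    have hi : ∀ y y', Integrable (fun k : Fin d → ℝ => f z * (Real.cos (phase d k z) * Real.cos (phase d k (y - y')))) μ := by
      intro y y'
      refine integrableOn_cube_of_continuous ?_
      have := continuous_phase (d := d) z; have := continuous_phase (d := d) (y - y'); fun_prop
    rw [integral_finsetSum _ (fun y _ => integrable_finsetSum _ (fun y' _ => hi y y'))]
    simp_rw [integral_finsetSum _ (fun y' _ => hi _ y'), integral_const_mul]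
    rw [Finset.mul_sum, Finset.mul_sum]
    refine Finset.sum_congr rfl fun y _ => ?_
    rw [Finset.mul_sum, Finset.mul_sum]
    refine Finset.sum_congr rfl fun y' _ => ?_
    rw [show (∫ k, Real.cos (phase d k z) * Real.cos (phase d k (y - y')) ∂μ)
        = (2 * π) ^ d / 2 * ((if z = y - y' then 1 else 0) + (if z = -(y - y') then 1 else 0))
        from integral_cube_cos_mul_cos z (y - y')]
    ring
  rw [hswap]
  simp_rw [hterm]
  rw [tsum_mul_left]
  -- Step 3: evaluate the sums of indicators
  have hs1 : Summable fun z => f z * ∑ y ∈ B, ∑ y' ∈ B,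
      ((if z = y - y' then (1:ℝ) else 0) + (if z = -(y - y') then 1 else 0)) := by
    refine Summable.of_norm_bounded (g := fun z => |f z| * (2 * (B.card : ℝ) ^ 2)) (hf.abs.mul_right _) fun z => ?_
    rw [Real.norm_eq_abs, abs_mul]
    refine mul_le_mul_of_nonneg_left ?_ (abs_nonneg _)
    rw [abs_of_nonneg (Finset.sum_nonneg fun y _ => Finset.sum_nonneg fun y' _ => by positivity)]
    calc ∑ y ∈ B, ∑ y' ∈ B, ((if z = y - y' then (1:ℝ) else 0) + (if z = -(y - y') then 1 else 0))
        ≤ ∑ y ∈ B, ∑ y' ∈ B, (2 : ℝ) :=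
          Finset.sum_le_sum fun y _ => Finset.sum_le_sum fun y' _ => by split_ifs <;> norm_num
      _ = 2 * (B.card : ℝ) ^ 2 := by simp [sq]; ring
  have hval : ∑' z, f z * ∑ y ∈ B, ∑ y' ∈ B,
      ((if z = y - y' then (1:ℝ) else 0) + (if z = -(y - y') then 1 else 0))
      = ∑ y ∈ B, ∑ y' ∈ B, (f (y - y') + f (y' - y)) := by
    have h2 : ∀ z, f z * ∑ y ∈ B, ∑ y' ∈ B,
        ((if z = y - y' then (1:ℝ) else 0) + (if z = -(y - y') then 1 else 0))
        = ∑ y ∈ B, ∑ y' ∈ B, ((if z = y - y' then f z else 0) + (if z = -(y - y') then f z else 0)) := by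
      intro z
      rw [Finset.mul_sum]
      refine Finset.sum_congr rfl fun y _ => ?_
      rw [Finset.mul_sum]
      refine Finset.sum_congr rfl fun y' _ => ?_
      split_ifs <;> ring
    simp_rw [h2]
    have hsa : ∀ w : Site d, Summable fun z => (if z = w then f z else 0) := by
      intro w
      apply summable_of_ne_finset_zero (s := {w})
      intro z hz; rw [Finset.mem_singleton] at hz; rw [if_neg hz]
    have hva : ∀ w : Site d, ∑' z, (if z = w then f z else 0) = f w := by
      intro w
      rw [tsum_eq_single w (fun z hz => if_neg hz)]
      rw [if_pos rfl]
    rw [Summable.tsum_finsetSum (fun y _ => summable_sum (fun y' _ => (hsa _).add (hsa _)))]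
    refine Finset.sum_congr rfl fun y _ => ?_
    rw [Summable.tsum_finsetSum (fun y' _ => (hsa _).add (hsa _))]
    refine Finset.sum_congr rfl fun y' _ => ?_
    rw [Summable.tsum_add (hsa _) (hsa _), hva, hva, neg_sub]
  rw [hval]
  have hsymm : ∑ y ∈ B, ∑ y' ∈ B, f (y' - y) = ∑ y ∈ B, ∑ y' ∈ B, f (y - y') := Finset.sum_comm
  simp_rw [Finset.sum_add_distrib]
  rw [hsymm]
  ring

end Ortho

end Summit.CriticalPhenomena.Ising3DConformalLimit.Theorems.EtaBoundsTransfer
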